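import Mathlib.RingTheory.Polynomial.Pochhammer
import Mathlib.RingTheory.MvPolynomial.Homogeneous
import Literature.NumberTheory.Transcendental.RoySmallValueEstimatesMahlerProofs
import Literature.NumberTheory.Transcendental.NesterenkoEliminationNorms
import HarnessLib

/-!
# Small value estimates at rational translates (Nguyen–Roy 2016) — proofs, VII: interpolation at the translates

Seventh proofs file towards `Literature.NumberTheory.Transcendental.nguyenRoy2016_thm_1` (Nguyen–Roy,
IJNT 12 (2016) = arXiv:1412.5163). We PROVE the interpolation estimate of **Proposition 8** of the
paper, in the cruder form that the authors point out is sufficient ("the formula of Mahler which we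
discussed after Lemma 7 yields instead a multiplier of the order of `c^{L³}`. This would have been
sufficient for our purpose", p. 6): for `r ≠ 0`, `η ≠ 0`, `|s| > 1`, `ξ ∈ ℂ`, the points
`γᵢ = (1, ξ + ir, η sⁱ)` and `M = (L+1)(L+2)/2 = dim ℂ[X₀,X₁,X₂]_L`, every ternary form `Q` of
degree `L` satisfies

  `‖Q‖₁ ≤ c^{(L+1)³} · max_{0 ≤ i < M} |Q(γᵢ)|`,  `c = 16 · max(1,|η|⁻¹)(1+|ξ|)max(1,|r|⁻¹) · |s| · min(1,|s|−1)⁻²`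

(`NguyenRoy.l1Norm_le_pow_mul_of_eval_translates`; `‖·‖₁ = Nesterenko.l1Norm`, the length `𝓛`), and
the explicit intermediate bound `NguyenRoy.l1Norm_le_of_eval_translates`. In particular the
evaluation map `Q ↦ (Q(γᵢ))_{i<M}` is injective on `ℂ[X]_L` (hence bijective onto `ℂ^M`, by
dimension; the dimension count is not formalised here). The printed constant `(c₂L)^{3L}` (first
assertion of Prop. 8) rests on a finer analysis of `a₀/a₁` and is NOT proved here.

Proof, following the paper: slice `Q(1, t, y) = ∑_{ν ≤ L} q_ν(t) y^ν` (`NguyenRoy.slicePoly`,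
`eval_eq_sum_slicePoly`), substitute `t = ξ + ri`, `y = ηsⁱ` (`q̃_ν = η^ν q_ν(ξ + rX)`), expand
`q̃_ν = ∑_μ a_{νμ} X^{(μ)}` in falling factorials (`exists_eq_sum_smul_descPochhammer`), so that
`Q(γᵢ) = ∑_ν ∑_μ (a_{νμ} s^{νμ}) i^{(μ)} (s^ν)^{i−μ}`; Lemma 7
(`norm_coeff_recurrence_le_of_bounds`, file IV) with `α_ν = s^ν`, `m_ν = L − ν + 1` and the crude
bounds `a₀ ≤ 4^M |s|^{LM}`, `a₁ ≥ θ^M`, `a₂ ≥ θ^{L+1}` (`θ = min(1, |s|−1)`, from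
`|s^a − s^b| ≥ |s| − 1`) bounds the `a_{νμ}` (`ulen_le_of_recurrence_bound`), hence the
coefficients of `q̃_ν` (`|[X^b]X^{(μ)}| ≤ μ!`), hence `𝓛(q_ν)` after undoing the substitution
(`ulen_le_of_comp_affine`), hence `‖Q‖₁ ≤ ∑ 𝓛(q_ν)`.

Definitions here are plumbing with bodies (`expVec`, `sliceCoeff`, `slicePoly`).

## References

* [NguyenRoy2016] N. A. V. Nguyen, D. Roy, IJNT 12 (2016) = arXiv:1412.5163, §3: Prop. 8, its proof,
  and the remark following it.
-/

noncomputable section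

open Polynomial Finset

namespace Literature.NumberTheory.Transcendental

namespace NguyenRoy

/-! ## Interpolation at the translates (towards Prop. 8): Stage A — falling-factorial expansions -/

/-- `|p_k| ≤ 𝓛(p)`. [folklore] -/
theorem norm_coeff_le_ulen (p : ℂ[X]) (k : ℕ) : ‖p.coeff k‖ ≤ ulen p := by
  by_cases hk : k ∈ p.support
  · exact Finset.single_le_sum (f := fun k => ‖p.coeff k‖) (fun _ _ => norm_nonneg _) hk
  · rw [notMem_support_iff.mp hk, norm_zero]; exact ulen_nonneg _

/-- `𝓛(X(X−1)⋯(X−μ+1)) ≤ μ!`. [folklore] -/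
theorem ulen_descPochhammer_le (μ : ℕ) : ulen (descPochhammer ℂ μ) ≤ μ.factorial := by
  induction μ with
  | zero => simp [descPochhammer_zero]
  | succ μ ih =>
    rw [descPochhammer_succ_right, Nat.factorial_succ, Nat.cast_mul, Nat.cast_succ]
    refine (ulen_mul_le _ _).trans ?_
    have h2 : ulen (X - (μ : ℂ[X])) = μ + 1 := by
      rw [← map_natCast C μ, ulen_X_sub_C, Complex.norm_natCast, add_comm]
    rw [h2, mul_comm]
    exact mul_le_mul_of_nonneg_left ih (by positivity)

/-- **Expansion in falling factorials.** A polynomial of degree `≤ d` is a combination of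
`X^{(μ)} = X(X−1)⋯(X−μ+1)`, `μ ≤ d`. [folklore] -/
theorem exists_eq_sum_smul_descPochhammer :
    ∀ (d : ℕ) (q : ℂ[X]), q.natDegree ≤ d →
      ∃ a : ℕ → ℂ, q = ∑ μ ∈ range (d + 1), a μ • descPochhammer ℂ μ := by
  intro d
  induction d with
  | zero =>
    intro q hq
    refine ⟨fun _ => q.coeff 0, ?_⟩
    rw [sum_range_one, descPochhammer_zero, smul_eq_C_mul, mul_one]
    exact eq_C_of_natDegree_le_zero hq
  | succ d ih =>
    intro q hq
    set c := q.coeff (d + 1) with hc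
    have hq' : (q - c • descPochhammer ℂ (d + 1)).natDegree ≤ d := by
      rw [natDegree_le_iff_coeff_eq_zero]
      intro N hN
      rw [coeff_sub, coeff_smul, smul_eq_mul]
      rcases Nat.lt_or_ge (d + 1) N with h | h
      · rw [coeff_eq_zero_of_natDegree_lt (hq.trans_lt h), coeff_eq_zero_of_natDegree_lt
          (by rw [descPochhammer_natDegree]; exact h), mul_zero, sub_zero]
      · have hN' : N = d + 1 := le_antisymm h hN
        subst hN'
        have hmonic := (monic_descPochhammer ℂ (d + 1)).coeff_natDegree
        rw [descPochhammer_natDegree] at hmonic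
        rw [hmonic, mul_one, hc, sub_self]
    obtain ⟨a, ha⟩ := ih _ hq'
    refine ⟨Function.update a (d + 1) c, ?_⟩
    rw [sum_range_succ, Function.update_self]
    have hsum : ∑ μ ∈ range (d + 1), Function.update a (d + 1) c μ • descPochhammer ℂ μ =
        ∑ μ ∈ range (d + 1), a μ • descPochhammer ℂ μ :=
      sum_congr rfl fun μ hμ => by rw [Function.update_of_ne (by have := mem_range.mp hμ; omega)]
    rw [hsum, ← ha]
    abel

/-- Coefficients of an expansion in falling factorials: `|[X^b] ∑ a_μ X^{(μ)}| ≤ ∑ |a_μ| μ!`.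
[folklore] -/
theorem norm_coeff_sum_smul_descPochhammer_le (d : ℕ) (a : ℕ → ℂ) (b : ℕ) :
    ‖(∑ μ ∈ range (d + 1), a μ • descPochhammer ℂ μ).coeff b‖ ≤
      ∑ μ ∈ range (d + 1), ‖a μ‖ * μ.factorial := by
  rw [finsetSum_coeff]
  refine (norm_sum_le _ _).trans (sum_le_sum fun μ _ => ?_)
  rw [coeff_smul, norm_smul]
  exact mul_le_mul_of_nonneg_left ((norm_coeff_le_ulen _ _).trans (ulen_descPochhammer_le μ))
    (norm_nonneg _)

/-- Values of an expansion in falling factorials at the integers are linear recurrence sequences: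
`(∑ a_μ X^{(μ)})(i) · αⁱ = ∑ (a_μ α^μ) · i^{(μ)} α^{i−μ}`. [cite: NguyenRoy2016, Prop. 8 (proof)] -/
theorem eval_sum_smul_descPochhammer_mul_pow (d : ℕ) (a : ℕ → ℂ) (α : ℂ) (i : ℕ) :
    (∑ μ ∈ range (d + 1), a μ • descPochhammer ℂ μ).eval (i : ℂ) * α ^ i =
      ∑ μ ∈ range (d + 1), (a μ * α ^ μ) * wseq μ α i := by
  rw [eval_finsetSum, sum_mul]
  refine sum_congr rfl fun μ _ => ?_
  rw [eval_smul, descPochhammer_eval_eq_descFactorial, smul_eq_mul, wseq_apply]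
  rcases le_or_gt μ i with h | h
  · rw [show α ^ i = α ^ μ * α ^ (i - μ) by rw [← pow_add, Nat.add_sub_cancel' h]]
    ring
  · rw [Nat.descFactorial_eq_zero_iff_lt.mpr h]
    simp

/-! ## Stage B — the recurrence bound for a family of polynomials `q_ν`, `deg q_ν ≤ L − ν` -/

/-- `|sᵃ − sᵇ| ≥ |s| − 1` for `a ≠ b` and `|s| ≥ 1`. [folklore] -/
theorem norm_sub_one_le_norm_pow_sub_pow {s : ℂ} (hs : 1 ≤ ‖s‖) {a b : ℕ} (hab : a ≠ b) :
    ‖s‖ - 1 ≤ ‖s ^ a - s ^ b‖ := by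
  wlog h : b < a generalizing a b
  · rw [norm_sub_rev]
    exact this (Ne.symm hab) (lt_of_le_of_ne (not_lt.mp h) hab)
  obtain ⟨k, rfl⟩ := Nat.exists_eq_add_of_lt h
  have hk : s ^ (b + k + 1) - s ^ b = s ^ b * (s ^ (k + 1) - 1) := by ring
  rw [hk, norm_mul, norm_pow]
  have h1 : ‖s‖ - 1 ≤ ‖s ^ (k + 1) - 1‖ := by
    calc ‖s‖ - 1 ≤ ‖s‖ ^ (k + 1) - 1 := by
          have := pow_le_pow_right₀ hs (Nat.le_add_left 1 k)
          rw [pow_one] at this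
          linarith
      _ = ‖s ^ (k + 1)‖ - ‖(1 : ℂ)‖ := by rw [norm_pow, norm_one]
      _ ≤ ‖s ^ (k + 1) - 1‖ := norm_sub_norm_le _ _
  calc ‖s‖ - 1 ≤ 1 * (‖s‖ - 1) := by rw [one_mul]
    _ ≤ ‖s‖ ^ b * ‖s ^ (k + 1) - 1‖ :=
        mul_le_mul (one_le_pow₀ hs) h1 (by linarith) (by positivity)

/-- `∑_{ν ≤ L} (L − ν + 1) = (L+1)(L+2)/2`, in the form `2 ∑ = (L+1)(L+2)`. [folklore] -/
theorem two_mul_sum_sub_add_one (L : ℕ) :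
    2 * ∑ ν : Fin (L + 1), (L - (ν : ℕ) + 1) = (L + 1) * (L + 2) := by
  rw [Fin.sum_univ_eq_sum_range (fun ν => L - ν + 1) (L + 1)]
  induction L with
  | zero => simp
  | succ L ih =>
    rw [sum_range_succ', Nat.sub_zero]
    have : ∑ k ∈ range (L + 1), (L + 1 - (k + 1) + 1) = ∑ k ∈ range (L + 1), (L - k + 1) :=
      sum_congr rfl fun k _ => by omega
    rw [this, mul_add, ih]
    ring

/-- **The recurrence bound (Lemma 7 with crude constants).** Let `|s| > 1`,
`θ = min(1, |s| − 1)`, `M = (L+1)(L+2)/2`, and let `q_ν ∈ ℂ[X]` (`ν ≤ L`) have `deg q_ν ≤ L − ν`. If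
`|∑_ν q_ν(i) s^{νi}| ≤ B` for `0 ≤ i < M`, then every `q_ν` has length
`𝓛(q_ν) ≤ (L+1)² L! · 4^M |s|^{LM} θ^{−(M+L+1)} · B`. (Expand `q_ν = ∑_μ a_{νμ} X^{(μ)}`; then
`u_i = ∑ (a_{νμ} s^{νμ}) i^{(μ)} (s^ν)^{i−μ}` and Lemma 7 applies with `α_ν = s^ν`,
`m_ν = L − ν + 1`, `a₀ ≤ 4^M |s|^{LM}`, `a₁ ≥ θ^M`, `a₂ ≥ θ^{L+1}`.)
[cite: NguyenRoy2016, Prop. 8 (proof)] -/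
theorem ulen_le_of_recurrence_bound {s : ℂ} (hs : 1 < ‖s‖) (L : ℕ) (q : ℕ → ℂ[X])
    (hq : ∀ ν ≤ L, (q ν).natDegree ≤ L - ν) {B : ℝ}
    (hB : ∀ i : ℕ, i < (L + 1) * (L + 2) / 2 →
      ‖∑ ν ∈ range (L + 1), (q ν).eval (i : ℂ) * (s ^ ν) ^ i‖ ≤ B) (ν : ℕ) (hν : ν ≤ L) :
    ulen (q ν) ≤ (L + 1) ^ 2 * L.factorial *
      ((4 : ℝ) ^ ((L + 1) * (L + 2) / 2) * ‖s‖ ^ (L * ((L + 1) * (L + 2) / 2)) *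
        (min 1 (‖s‖ - 1))⁻¹ ^ ((L + 1) * (L + 2) / 2 + L + 1)) * B := by
  classical
  have hs0 : s ≠ 0 := fun h => by rw [h, norm_zero] at hs; linarith
  -- notation and the constants
  set S : ℝ := ‖s‖ with hS
  set θ : ℝ := min 1 (‖s‖ - 1) with hθ
  have hθpos : 0 < θ := lt_min one_pos (by linarith)
  have hθ1 : θ ≤ 1 := min_le_left _ _
  have hS1 : 1 ≤ S := hs.le
  set M : ℕ := (L + 1) * (L + 2) / 2 with hM
  have hM2 : 2 * M = (L + 1) * (L + 2) := by
    rw [hM]; exact Nat.two_mul_div_two_of_even (Nat.even_mul_succ_self (L + 1))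
  have hMpos : 0 < M := by
    rw [hM]
    refine Nat.div_pos ?_ two_pos
    calc 2 = 1 * 2 := rfl
      _ ≤ (L + 1) * (L + 2) := Nat.mul_le_mul (by omega) (by omega)
  -- expansions in falling factorials
  have hexp : ∀ ν, ∃ a : ℕ → ℂ, ν ≤ L →
      q ν = ∑ μ ∈ range (L - ν + 1), a μ • descPochhammer ℂ μ := by
    intro ν
    by_cases h : ν ≤ L
    · obtain ⟨a, ha⟩ := exists_eq_sum_smul_descPochhammer (L - ν) (q ν) (hq ν h)
      exact ⟨a, fun _ => ha⟩
    · exact ⟨fun _ => 0, fun h' => absurd h' h⟩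
  choose a ha using hexp
  -- the data of Lemma 7
  set α : Fin (L + 1) → ℂ := fun ν => s ^ (ν : ℕ) with hα
  set mult : Fin (L + 1) → ℕ := fun ν => L - ν + 1 with hmult
  set A : Fin (L + 1) → ℕ → ℂ := fun ν μ => a ν μ * (s ^ (ν : ℕ)) ^ μ with hA
  have hαinj : Function.Injective α := by
    intro i j h
    have h' := congrArg (fun z => ‖z‖) h
    simp only [hα, norm_pow] at h'
    exact Fin.ext (pow_right_injective₀ (by positivity) hs.ne' h')
  have hsumM : ∑ ν', mult ν' = M := by
    have h2 := two_mul_sum_sub_add_one L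
    rw [← hM2] at h2
    exact Nat.eq_of_mul_eq_mul_left two_pos h2
  -- the sequence identity
  have hu : ∀ i : ℕ, (∑ ν', ∑ μ ∈ range (mult ν'), A ν' μ • wseq μ (α ν')) i =
      ∑ ν ∈ range (L + 1), (q ν).eval (i : ℂ) * (s ^ ν) ^ i := by
    intro i
    rw [Finset.sum_apply, ← Fin.sum_univ_eq_sum_range]
    refine sum_congr rfl fun ν' _ => ?_
    rw [Finset.sum_apply, ha ν' (Nat.lt_succ_iff.mp ν'.2), eval_sum_smul_descPochhammer_mul_pow]
    rfl
  have hB' : ∀ i < ∑ ν', mult ν', ‖(∑ ν', ∑ μ ∈ range (mult ν'), A ν' μ • wseq μ (α ν')) i‖ ≤ B := by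
    intro i hi
    rw [hu]
    exact hB i (by rwa [hsumM] at hi)
  -- lower bounds for the differences `|s^ν' − s^ν|`
  have hdiff : ∀ ν₁ ν₂ : Fin (L + 1), ν₁ ≠ ν₂ → θ ≤ ‖α ν₁ - α ν₂‖ := by
    intro ν₁ ν₂ h
    refine (min_le_right _ _).trans (norm_sub_one_le_norm_pow_sub_pow hs.le ?_)
    exact fun h' => h (Fin.ext h')
  -- apply Lemma 7 at `(ν, μ)` for each `μ ≤ L − ν`
  set ν₀ : Fin (L + 1) := ⟨ν, Nat.lt_succ_of_le hν⟩ with hν₀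
  have hK : ∀ μ, μ < L - ν + 1 → ‖a ν μ‖ ≤
      ((4 : ℝ) ^ M * S ^ (L * M) * θ⁻¹ ^ (M + L + 1)) * B := by
    intro μ hμ
    have h7 := norm_coeff_recurrence_le_of_bounds α hαinj mult A hB' ν₀ (μ := μ)
      (show μ < L - ν + 1 from hμ)
      (a₀ := (M.choose (mult ν₀) : ℝ) * ∏ ν', (1 + ‖α ν'‖) ^ mult ν')
      (a₁ := θ ^ M) (a₂ := θ ^ (L + 1)) (by rw [hsumM]) (pow_pos hθpos _) ?_ (pow_pos hθpos _)
      (pow_le_one₀ hθpos.le hθ1) ?_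
    rotate_left
    · -- `θ^M ≤ ∏_{ν'≠ν} |α ν' − α ν|^{mult ν'}`
      calc θ ^ M ≤ θ ^ ∑ ν' ∈ univ.erase ν₀, mult ν' :=
            pow_le_pow_of_le_one hθpos.le hθ1
              (by rw [← hsumM]; exact sum_le_sum_of_subset (erase_subset _ _))
        _ = ∏ ν' ∈ univ.erase ν₀, θ ^ mult ν' := (prod_pow_eq_pow_sum _ _ _).symm
        _ ≤ _ := prod_le_prod (fun _ _ => by positivity) fun ν' hν' =>
            pow_le_pow_left₀ hθpos.le (hdiff ν' ν₀ (ne_of_mem_erase hν')) _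
    · -- `θ^{L+1} ≤ |α ν' − α ν|^{mult ν}`
      intro ν' hν'
      have hx := hdiff ν' ν₀ hν'
      calc θ ^ (L + 1) ≤ θ ^ mult ν₀ :=
            pow_le_pow_of_le_one hθpos.le hθ1 (by simp [hmult])
        _ ≤ _ := pow_le_pow_left₀ hθpos.le hx _
    -- `h7 : ‖A ν₀ μ‖ ≤ a₀ / (θ^M θ^{L+1}) · B`; compare
    have hB0 : 0 ≤ B := (norm_nonneg _).trans (hB' 0 (by rw [hsumM]; exact hMpos))
    have hAa : ‖a ν μ‖ ≤ ‖A ν₀ μ‖ := by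
      simp only [hA, hν₀, norm_mul, norm_pow]
      exact le_mul_of_one_le_right (norm_nonneg _) (one_le_pow₀ (one_le_pow₀ hs.le))
    refine hAa.trans (h7.trans ?_)
    -- `a₀ ≤ 4^M S^{LM}` and `1/(θ^M θ^{L+1}) = θ⁻¹^{M+L+1}`
    have ha₀ : (M.choose (mult ν₀) : ℝ) * ∏ ν', (1 + ‖α ν'‖) ^ mult ν' ≤ 4 ^ M * S ^ (L * M) := by
      have h1 : (M.choose (mult ν₀) : ℝ) ≤ 2 ^ M := by
        exact_mod_cast (Nat.choose_le_two_pow M (mult ν₀))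
      have h2 : ∏ ν', (1 + ‖α ν'‖) ^ mult ν' ≤ ∏ ν' : Fin (L + 1), (2 * S ^ L) ^ mult ν' := by
        refine prod_le_prod (fun _ _ => by positivity) fun ν' _ => pow_le_pow_left₀ (by positivity) ?_ _
        simp only [hα, norm_pow]
        have : ‖s‖ ^ (ν' : ℕ) ≤ S ^ L := pow_le_pow_right₀ hS1 (Nat.lt_succ_iff.mp ν'.2)
        have : 1 ≤ S ^ L := one_le_pow₀ hS1
        linarith
      rw [prod_pow_eq_pow_sum, hsumM] at h2
      calc _ ≤ (2 : ℝ) ^ M * (2 * S ^ L) ^ M := mul_le_mul h1 h2 (by positivity) (by positivity)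
        _ = 4 ^ M * S ^ (L * M) := by rw [mul_pow, ← mul_assoc, ← mul_pow, ← pow_mul]; norm_num
    rw [div_eq_mul_inv, mul_inv, ← inv_pow, ← inv_pow, ← pow_add, show M + (L + 1) = M + L + 1 by ring]
    exact mul_le_mul_of_nonneg_right (mul_le_mul_of_nonneg_right ha₀ (by positivity)) hB0
  -- coefficients and length of `q ν`
  have hcoeff : ∀ b, ‖(q ν).coeff b‖ ≤ (L + 1) * L.factorial *
      (((4 : ℝ) ^ M * S ^ (L * M) * θ⁻¹ ^ (M + L + 1)) * B) := by
    intro b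
    rw [ha ν hν]
    refine (norm_coeff_sum_smul_descPochhammer_le _ _ _).trans ?_
    calc ∑ μ ∈ range (L - ν + 1), ‖a ν μ‖ * μ.factorial
        ≤ ∑ _μ ∈ range (L - ν + 1), (((4 : ℝ) ^ M * S ^ (L * M) * θ⁻¹ ^ (M + L + 1)) * B) *
            L.factorial := by
          refine sum_le_sum fun μ hμ => ?_
          have hμ' := mem_range.mp hμ
          refine mul_le_mul (hK μ hμ') ?_ (by positivity) ?_
          · exact_mod_cast Nat.factorial_le ((Nat.lt_succ_iff.mp hμ').trans (Nat.sub_le L ν))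
          · have hB0 : 0 ≤ B := (norm_nonneg _).trans (hB' 0 (by rw [hsumM]; exact hMpos))
            positivity
      _ = (L - ν + 1 : ℕ) * ((((4 : ℝ) ^ M * S ^ (L * M) * θ⁻¹ ^ (M + L + 1)) * B) * L.factorial) := by
          rw [sum_const, card_range, nsmul_eq_mul]
      _ ≤ (L + 1 : ℝ) * ((((4 : ℝ) ^ M * S ^ (L * M) * θ⁻¹ ^ (M + L + 1)) * B) * L.factorial) := by
          have hB0 : 0 ≤ B := (norm_nonneg _).trans (hB' 0 (by rw [hsumM]; exact hMpos))
          refine mul_le_mul_of_nonneg_right ?_ (by positivity)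
          exact_mod_cast Nat.succ_le_succ (Nat.sub_le L ν)
      _ = _ := by ring
  have hdeg : (q ν).natDegree < L + 1 := Nat.lt_succ_of_le ((hq ν hν).trans (Nat.sub_le _ _))
  rw [ulen_eq_sum_range hdeg]
  calc ∑ b ∈ range (L + 1), ‖(q ν).coeff b‖
      ≤ ∑ _b ∈ range (L + 1), (L + 1) * L.factorial *
          (((4 : ℝ) ^ M * S ^ (L * M) * θ⁻¹ ^ (M + L + 1)) * B) := sum_le_sum fun b _ => hcoeff b
    _ = _ := by rw [sum_const, card_range, nsmul_eq_mul]; push_cast; ring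

/-! ## Stage C — ternary forms: slices, evaluation at `(1, t, y)`, and the interpolation estimate -/

/-- The exponent vector `(L − b − ν, b, ν)` of `X₀^{L−b−ν} X₁ᵇ X₂^ν`. [folklore] -/
def expVec (L b ν : ℕ) : Fin 3 →₀ ℕ :=
  Finsupp.single 0 (L - b - ν) + Finsupp.single 1 b + Finsupp.single 2 ν

/-- The coefficient of `X₀^{L−b−ν} X₁ᵇ X₂^ν` in `Q`. [folklore] -/
def sliceCoeff (Q : MvPolynomial (Fin 3) ℂ) (L b ν : ℕ) : ℂ := Q.coeff (expVec L b ν)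

/-- The `ν`-th slice `q_ν(t) = ∑_b Q_{bν} tᵇ` of a ternary form `Q` of degree `L`, so that
`Q(1, t, y) = ∑_ν q_ν(t) y^ν`. [cite: NguyenRoy2016, Prop. 8 (proof, "writing P in the form …")] -/
def slicePoly (Q : MvPolynomial (Fin 3) ℂ) (L ν : ℕ) : ℂ[X] :=
  ∑ b ∈ range (L + 1), C (sliceCoeff Q L b ν) * X ^ b

/-- `expVec L b ν 0 = L − b − ν`. [folklore] -/
@[simp] theorem expVec_zero (L b ν : ℕ) : expVec L b ν 0 = L - b - ν := by
  simp [expVec]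

/-- `expVec L b ν 1 = b`. [folklore] -/
@[simp] theorem expVec_one (L b ν : ℕ) : expVec L b ν 1 = b := by
  simp [expVec]

/-- `expVec L b ν 2 = ν`. [folklore] -/
@[simp] theorem expVec_two (L b ν : ℕ) : expVec L b ν 2 = ν := by
  simp [expVec]

/-- Degree of the exponent vector. [folklore] -/
theorem degree_expVec (L b ν : ℕ) : (expVec L b ν).degree = (L - b - ν) + b + ν := by
  rw [Finsupp.degree_eq_sum, Fin.sum_univ_three, expVec_zero, expVec_one, expVec_two]

/-- A monomial of a form of degree `L` is `X₀^{L−b−ν} X₁ᵇ X₂^ν` with `(b, ν) = (d₁, d₂)`. [folklore] -/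
theorem eq_expVec_of_mem_support {Q : MvPolynomial (Fin 3) ℂ} {L : ℕ} (hQ : Q.IsHomogeneous L)
    {d : Fin 3 →₀ ℕ} (hd : d ∈ Q.support) : d = expVec L (d 1) (d 2) ∧ d 1 ≤ L ∧ d 2 ≤ L := by
  have hdeg : d.degree = L := by
    rw [Finsupp.degree_eq_weight_one]
    exact hQ (MvPolynomial.mem_support_iff.mp hd)
  rw [Finsupp.degree_eq_sum, Fin.sum_univ_three] at hdeg
  refine ⟨?_, by omega, by omega⟩
  ext i
  fin_cases i
  · simp; omega
  · simp
  · simp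

/-- Coefficients of the slices. [folklore] -/
theorem coeff_slicePoly (Q : MvPolynomial (Fin 3) ℂ) (L ν b : ℕ) :
    (slicePoly Q L ν).coeff b = if b < L + 1 then sliceCoeff Q L b ν else 0 := by
  rw [slicePoly, finsetSum_coeff]
  simp_rw [coeff_C_mul_X_pow]
  rw [Finset.sum_ite_eq]
  simp only [mem_range]

/-- Slice coefficients beyond the degree vanish. [folklore] -/
theorem sliceCoeff_eq_zero_of_lt {Q : MvPolynomial (Fin 3) ℂ} {L : ℕ} (hQ : Q.IsHomogeneous L)
    {b ν : ℕ} (h : L < b + ν) : sliceCoeff Q L b ν = 0 := by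
  rw [sliceCoeff]
  refine hQ.coeff_eq_zero ?_
  rw [degree_expVec]
  omega

/-- `deg q_ν ≤ L − ν`. [cite: NguyenRoy2016, Prop. 8 (proof)] -/
theorem natDegree_slicePoly_le {Q : MvPolynomial (Fin 3) ℂ} {L : ℕ} (hQ : Q.IsHomogeneous L)
    (ν : ℕ) : (slicePoly Q L ν).natDegree ≤ L - ν := by
  rw [natDegree_le_iff_coeff_eq_zero]
  intro N hN
  rw [coeff_slicePoly]
  split_ifs with h
  · exact sliceCoeff_eq_zero_of_lt hQ (by omega)
  · rfl

/-- `𝓛(q_ν) = ∑_{b ≤ L} |Q_{bν}|`. [folklore] -/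
theorem ulen_slicePoly (Q : MvPolynomial (Fin 3) ℂ) (L ν : ℕ) :
    ulen (slicePoly Q L ν) = ∑ b ∈ range (L + 1), ‖sliceCoeff Q L b ν‖ := by
  have hdeg : (slicePoly Q L ν).natDegree < L + 1 := by
    refine Nat.lt_succ_of_le (natDegree_sum_le_of_forall_le _ _ fun b hb => ?_)
    exact (natDegree_C_mul_X_pow_le _ _).trans (Nat.lt_succ_iff.mp (mem_range.mp hb))
  rw [ulen_eq_sum_range hdeg]
  exact sum_congr rfl fun b hb => by rw [coeff_slicePoly, if_pos (mem_range.mp hb)]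

/-- **Slicing a form**: `Q(1, t, y) = ∑_{ν ≤ L} q_ν(t) y^ν`. [cite: NguyenRoy2016, Prop. 8 (proof)] -/
theorem eval_eq_sum_slicePoly {Q : MvPolynomial (Fin 3) ℂ} {L : ℕ} (hQ : Q.IsHomogeneous L)
    (t y : ℂ) :
    MvPolynomial.eval ![1, t, y] Q = ∑ ν ∈ range (L + 1), (slicePoly Q L ν).eval t * y ^ ν := by
  classical
  set e : ℕ × ℕ → (Fin 3 →₀ ℕ) := fun p => expVec L p.1 p.2 with he
  set R : Finset (ℕ × ℕ) := range (L + 1) ×ˢ range (L + 1) with hR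
  have heinj : Set.InjOn e R := by
    intro p _ p' _ h
    have h1 := congrArg (fun d => d 1) h
    have h2 := congrArg (fun d => d 2) h
    simp only [he, expVec_one, expVec_two] at h1 h2
    exact Prod.ext h1 h2
  have hsupp : Q.support ⊆ R.image e := by
    intro d hd
    obtain ⟨hde, h1, h2⟩ := eq_expVec_of_mem_support hQ hd
    exact mem_image.mpr ⟨(d 1, d 2), by rw [hR, mem_product, mem_range, mem_range]; omega,
      hde.symm⟩
  set g : (Fin 3 →₀ ℕ) → ℂ := fun d => Q.coeff d * t ^ d 1 * y ^ d 2 with hg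
  -- left-hand side as a sum of `g` over the support
  have hL : MvPolynomial.eval ![1, t, y] Q = ∑ d ∈ Q.support, g d := by
    rw [MvPolynomial.eval_eq']
    refine sum_congr rfl fun d _ => ?_
    rw [Fin.prod_univ_three]
    simp [hg, mul_assoc]
  -- right-hand side as a sum of `g ∘ e` over `R`
  have hRHS : ∑ ν ∈ range (L + 1), (slicePoly Q L ν).eval t * y ^ ν = ∑ p ∈ R, g (e p) := by
    rw [hR, sum_product, sum_comm]
    refine sum_congr rfl fun ν _ => ?_
    rw [slicePoly, eval_finsetSum, sum_mul]
    refine sum_congr rfl fun b _ => ?_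
    simp [hg, he, sliceCoeff, eval_pow, eval_X, eval_C]
  have himg : ∑ x ∈ R.image e, g x = ∑ p ∈ R, g (e p) := Finset.sum_image heinj
  rw [hL, hRHS, ← himg]
  refine Finset.sum_subset (f := g) hsupp fun d _ hd => ?_
  rw [hg]
  simp [MvPolynomial.notMem_support_iff.mp hd]

/-- **Length through slices**: `‖Q‖₁ ≤ ∑_ν 𝓛(q_ν)`. [folklore] -/
theorem l1Norm_le_sum_ulen_slicePoly {Q : MvPolynomial (Fin 3) ℂ} {L : ℕ} (hQ : Q.IsHomogeneous L) :
    Nesterenko.l1Norm Q ≤ ∑ ν ∈ range (L + 1), ulen (slicePoly Q L ν) := by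
  classical
  set e : ℕ × ℕ → (Fin 3 →₀ ℕ) := fun p => expVec L p.1 p.2 with he
  set R : Finset (ℕ × ℕ) := range (L + 1) ×ˢ range (L + 1) with hR
  have hsupp : Q.support ⊆ R.image e := by
    intro d hd
    obtain ⟨hde, h1, h2⟩ := eq_expVec_of_mem_support hQ hd
    exact mem_image.mpr ⟨(d 1, d 2), by rw [hR, mem_product, mem_range, mem_range]; omega,
      hde.symm⟩
  calc Nesterenko.l1Norm Q = ∑ d ∈ Q.support, ‖Q.coeff d‖ := rfl
    _ ≤ ∑ d ∈ R.image e, ‖Q.coeff d‖ :=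
        sum_le_sum_of_subset_of_nonneg hsupp fun _ _ _ => norm_nonneg _
    _ ≤ ∑ p ∈ R, ‖Q.coeff (e p)‖ := sum_image_le_of_nonneg fun _ _ => norm_nonneg _
    _ = ∑ ν ∈ range (L + 1), ulen (slicePoly Q L ν) := by
        rw [hR, sum_product, sum_comm]
        refine sum_congr rfl fun ν _ => ?_
        rw [ulen_slicePoly]
        rfl

/-- Undoing the substitution `t = ξ + rX`: lengths. For `q̃ = η^ν · q(ξ + rX)` one has
`q = (η^ν)⁻¹ · (q̃(r⁻¹X))(X − ξ)` and `𝓛(q) ≤ (max(1,|η|⁻¹)(1+|ξ|)max(1,|r|⁻¹))^L 𝓛(q̃)` when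
`ν, deg q̃ ≤ L`. [folklore] -/
theorem ulen_le_of_comp_affine {r ξ η : ℂ} (hr : r ≠ 0) (hη : η ≠ 0) {L ν : ℕ} (hν : ν ≤ L)
    (q : ℂ[X]) (hdeg : (C (η ^ ν) * q.comp (C ξ + C r * X)).natDegree ≤ L) :
    ulen q ≤ (max 1 ‖η‖⁻¹ * (1 + ‖ξ‖) * max 1 ‖r‖⁻¹) ^ L *
      ulen (C (η ^ ν) * q.comp (C ξ + C r * X)) := by
  set qt := C (η ^ ν) * q.comp (C ξ + C r * X) with hqt
  have hην : η ^ ν ≠ 0 := pow_ne_zero _ hη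
  -- invert the substitution
  have hback : q = C (η ^ ν)⁻¹ * ((qt.comp (C r⁻¹ * X)).comp (X + C (-ξ))) := by
    have h1 : qt.comp (C r⁻¹ * X) = C (η ^ ν) * q.comp (C ξ + X) := by
      rw [hqt, mul_comp, C_comp, comp_assoc, add_comp, C_comp, mul_comp, C_comp, X_comp,
        ← mul_assoc, ← C_mul, mul_inv_cancel₀ hr, C_1, one_mul]
    have h2 : (q.comp (C ξ + X)).comp (X + C (-ξ)) = q := by
      rw [comp_assoc, add_comp, C_comp, X_comp, C_neg]
      simp
    rw [h1, mul_comp, C_comp, h2, ← mul_assoc, ← C_mul, inv_mul_cancel₀ hην, C_1, one_mul]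
  -- lengths
  have hdeg1 : (qt.comp (C r⁻¹ * X)).natDegree ≤ L := by
    refine natDegree_comp_le.trans ?_
    rw [natDegree_C_mul_X _ (inv_ne_zero hr), mul_one]
    exact hdeg
  have h1 : ulen (qt.comp (C r⁻¹ * X)) ≤ ulen qt * (max 1 ‖r‖⁻¹) ^ L := by
    rw [ulen_comp_C_mul_X _ _ (inv_ne_zero hr), norm_inv, ulen_eq_sum_range (Nat.lt_succ_self _),
      sum_mul]
    refine sum_le_sum fun k hk => mul_le_mul_of_nonneg_left ?_ (norm_nonneg _)
    have hkL : k ≤ L := (Nat.lt_succ_iff.mp (mem_range.mp hk)).trans (hqt ▸ hdeg)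
    calc ‖r‖⁻¹ ^ k ≤ (max 1 ‖r‖⁻¹) ^ k := pow_le_pow_left₀ (by positivity) (le_max_right _ _) _
      _ ≤ (max 1 ‖r‖⁻¹) ^ L := pow_le_pow_right₀ (le_max_left _ _) hkL
  have h2 : ulen ((qt.comp (C r⁻¹ * X)).comp (X + C (-ξ))) ≤
      ulen qt * (max 1 ‖r‖⁻¹) ^ L * (1 + ‖ξ‖) ^ L := by
    refine (ulen_comp_X_add_C_le _ _).trans ?_
    rw [norm_neg]
    exact mul_le_mul h1 (pow_le_pow_right₀ (le_add_of_nonneg_right (norm_nonneg _)) hdeg1)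
      (by positivity) (mul_nonneg (ulen_nonneg _) (by positivity))
  have h3 : ‖(η ^ ν)⁻¹‖ ≤ (max 1 ‖η‖⁻¹) ^ L := by
    rw [norm_inv, norm_pow, ← inv_pow]
    calc ‖η‖⁻¹ ^ ν ≤ (max 1 ‖η‖⁻¹) ^ ν := pow_le_pow_left₀ (by positivity) (le_max_right _ _) _
      _ ≤ (max 1 ‖η‖⁻¹) ^ L := pow_le_pow_right₀ (le_max_left _ _) hν
  calc ulen q = ‖(η ^ ν)⁻¹‖ * ulen ((qt.comp (C r⁻¹ * X)).comp (X + C (-ξ))) := by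
        conv_lhs => rw [hback]
        rw [ulen_C_mul]
    _ ≤ (max 1 ‖η‖⁻¹) ^ L * (ulen qt * (max 1 ‖r‖⁻¹) ^ L * (1 + ‖ξ‖) ^ L) :=
        mul_le_mul h3 h2 (ulen_nonneg _) (by positivity)
    _ = _ := by rw [mul_pow, mul_pow]; ring

/-- **Interpolation at the translates (Nguyen–Roy 2016, Prop. 8, with an explicit cruder constant).**
Let `r ≠ 0`, `η ≠ 0`, `|s| > 1`, `ξ ∈ ℂ`, `γᵢ = (1, ξ + ir, η sⁱ)`, `L ∈ ℕ`, `M = (L+1)(L+2)/2`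
(`= dim ℂ[X₀,X₁,X₂]_L`). Every ternary form `Q` of degree `L` satisfies
`‖Q‖₁ ≤ K(L) · max_{0 ≤ i < M} |Q(γᵢ)|` with the explicit
`K(L) = (L+1) c₁^L (L+1)² L! 4^M |s|^{LM} θ^{−(M+L+1)}`, `c₁ = max(1,|η|⁻¹)(1+|ξ|)max(1,|r|⁻¹)`,
`θ = min(1, |s| − 1)` — in particular the evaluation map `Q ↦ (Q(γᵢ))_{i<M}` is injective on
`ℂ[X]_L`. The paper proves the sharper `𝓛(Q) ≤ (c₂L)^{3L} max |Q(γᵢ)|` (first assertion of Prop. 8)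
by a finer analysis of `a₀/a₁`; as the authors note ("the formula of Mahler … yields instead a
multiplier of the order of `c^{L³}`. This would have been sufficient for our purpose"), a constant
`exp(O(L³))` such as `K(L)` is all that Prop. 10 and §5 consume. Proof: slice `Q(1,t,y) = ∑ q_ν(t)y^ν`,
substitute `t = ξ + ri`, `y = ηsⁱ`, and apply Lemma 7 (`ulen_le_of_recurrence_bound`).
[cite: NguyenRoy2016, Prop. 8 (proof) and the remark following it] -/
theorem l1Norm_le_of_eval_translates {r s ξ η : ℂ} (hr : r ≠ 0) (hη : η ≠ 0) (hs : 1 < ‖s‖)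
    {L : ℕ} {Q : MvPolynomial (Fin 3) ℂ} (hQ : Q.IsHomogeneous L) {B : ℝ}
    (hB : ∀ i : ℕ, i < (L + 1) * (L + 2) / 2 →
      ‖MvPolynomial.eval ![1, ξ + i * r, η * s ^ i] Q‖ ≤ B) :
    Nesterenko.l1Norm Q ≤ (L + 1) * (max 1 ‖η‖⁻¹ * (1 + ‖ξ‖) * max 1 ‖r‖⁻¹) ^ L *
      ((L + 1) ^ 2 * L.factorial *
        ((4 : ℝ) ^ ((L + 1) * (L + 2) / 2) * ‖s‖ ^ (L * ((L + 1) * (L + 2) / 2)) *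
          (min 1 (‖s‖ - 1))⁻¹ ^ ((L + 1) * (L + 2) / 2 + L + 1)) * B) := by
  -- the substituted slices
  set qt : ℕ → ℂ[X] := fun ν => C (η ^ ν) * (slicePoly Q L ν).comp (C ξ + C r * X) with hqt
  have hlin : (C ξ + C r * X : ℂ[X]).natDegree ≤ 1 :=
    (natDegree_add_le _ _).trans (max_le (by simp) ((natDegree_C_mul_le _ _).trans natDegree_X_le))
  have hq : ∀ ν ≤ L, (qt ν).natDegree ≤ L - ν := by
    intro ν hν
    refine (natDegree_C_mul_le _ _).trans (natDegree_comp_le.trans ?_)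
    calc (slicePoly Q L ν).natDegree * (C ξ + C r * X : ℂ[X]).natDegree
        ≤ (slicePoly Q L ν).natDegree * 1 := Nat.mul_le_mul_left _ hlin
      _ ≤ L - ν := by rw [mul_one]; exact natDegree_slicePoly_le hQ ν
  -- the values at the integers are the values of `Q` at the translates
  have hval : ∀ i : ℕ, ∑ ν ∈ range (L + 1), (qt ν).eval (i : ℂ) * (s ^ ν) ^ i =
      MvPolynomial.eval ![1, ξ + i * r, η * s ^ i] Q := by
    intro i
    rw [eval_eq_sum_slicePoly hQ]
    refine sum_congr rfl fun ν _ => ?_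
    simp only [hqt, eval_mul, eval_C, eval_comp, eval_add, eval_X]
    ring
  have hBq : ∀ i : ℕ, i < (L + 1) * (L + 2) / 2 →
      ‖∑ ν ∈ range (L + 1), (qt ν).eval (i : ℂ) * (s ^ ν) ^ i‖ ≤ B := fun i hi => by
    rw [hval]; exact hB i hi
  -- Lemma 7 for each slice, then undo the substitution
  have hB0 : 0 ≤ B := by
    have h := hBq 0 (Nat.div_pos
      (by have key : (L + 1) * (L + 2) = 2 + (L ^ 2 + 3 * L) := by ring
          omega) two_pos)
    exact (norm_nonneg _).trans h
  set K : ℝ := (L + 1) ^ 2 * L.factorial *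
    ((4 : ℝ) ^ ((L + 1) * (L + 2) / 2) * ‖s‖ ^ (L * ((L + 1) * (L + 2) / 2)) *
      (min 1 (‖s‖ - 1))⁻¹ ^ ((L + 1) * (L + 2) / 2 + L + 1)) with hK
  set c₁ : ℝ := max 1 ‖η‖⁻¹ * (1 + ‖ξ‖) * max 1 ‖r‖⁻¹ with hc₁
  have hslice : ∀ ν ∈ range (L + 1), ulen (slicePoly Q L ν) ≤ c₁ ^ L * (K * B) := by
    intro ν hν
    have hνL : ν ≤ L := Nat.lt_succ_iff.mp (mem_range.mp hν)
    have h7 : ulen (qt ν) ≤ K * B := ulen_le_of_recurrence_bound hs L qt hq hBq ν hνL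
    have hdegL : (qt ν).natDegree ≤ L := (hq ν hνL).trans (Nat.sub_le _ _)
    refine (ulen_le_of_comp_affine hr hη hνL (slicePoly Q L ν) hdegL).trans ?_
    exact mul_le_mul_of_nonneg_left h7 (by positivity)
  calc Nesterenko.l1Norm Q ≤ ∑ ν ∈ range (L + 1), ulen (slicePoly Q L ν) :=
        l1Norm_le_sum_ulen_slicePoly hQ
    _ ≤ ∑ _ν ∈ range (L + 1), c₁ ^ L * (K * B) := sum_le_sum hslice
    _ = (L + 1) * c₁ ^ L * (K * B) := by
        rw [sum_const, card_range, nsmul_eq_mul]; push_cast; ring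

/-! ### The constant in the form `c^{(L+1)³}` -/

/-- `L! ≤ (L+1)^L`. [folklore] -/
theorem factorial_le_succ_pow (L : ℕ) : L.factorial ≤ (L + 1) ^ L := by
  induction L with
  | zero => simp
  | succ L ih =>
    rw [Nat.factorial_succ, pow_succ']
    calc (L + 1) * L.factorial ≤ (L + 1) * (L + 1) ^ L := Nat.mul_le_mul_left _ ih
      _ ≤ (L + 2) * (L + 2) ^ L :=
          Nat.mul_le_mul (by omega) (Nat.pow_le_pow_left (by omega) _)

/-- `(L+1)³ L! ≤ 2^{2(L+1)³}`. [folklore] -/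
theorem succ_pow_three_mul_factorial_le (L : ℕ) :
    (L + 1) ^ 3 * L.factorial ≤ 2 ^ (2 * (L + 1) ^ 3) := by
  have h1 : L + 1 ≤ 2 ^ L := Nat.lt_two_pow_self
  calc (L + 1) ^ 3 * L.factorial ≤ (L + 1) ^ 3 * (L + 1) ^ L :=
        Nat.mul_le_mul_left _ (factorial_le_succ_pow L)
    _ = (L + 1) ^ (L + 3) := by ring
    _ ≤ (2 ^ L) ^ (L + 3) := Nat.pow_le_pow_left h1 _
    _ = 2 ^ (L * (L + 3)) := by rw [← pow_mul]
    _ ≤ 2 ^ (2 * (L + 1) ^ 3) := Nat.pow_le_pow_right two_pos (by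
        have key : 2 * (L + 1) ^ 3 = L * (L + 3) + (2 * L ^ 3 + 5 * L ^ 2 + 3 * L + 2) := by ring
        omega)

/-- The exponent bookkeeping: with `M = (L+1)(L+2)/2`, one has `M ≤ (L+1)³`, `LM ≤ (L+1)³`,
`M + L + 1 ≤ 2(L+1)³`. [folklore] -/
theorem triangular_bounds (L : ℕ) :
    (L + 1) * (L + 2) / 2 ≤ (L + 1) ^ 3 ∧ L * ((L + 1) * (L + 2) / 2) ≤ (L + 1) ^ 3 ∧
      (L + 1) * (L + 2) / 2 + L + 1 ≤ 2 * (L + 1) ^ 3 := by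
  set M := (L + 1) * (L + 2) / 2 with hM
  have hM2 : 2 * M = (L + 1) * (L + 2) := by
    rw [hM]; exact Nat.two_mul_div_two_of_even (Nat.even_mul_succ_self (L + 1))
  refine ⟨?_, ?_, ?_⟩
  · have key : 2 * (L + 1) ^ 3 = (L + 1) * (L + 2) + (2 * L ^ 3 + 5 * L ^ 2 + 3 * L) := by ring
    omega
  · have key : 2 * (L + 1) ^ 3 = L * ((L + 1) * (L + 2)) + (L ^ 3 + 3 * L ^ 2 + 4 * L + 2) := by
      ring
    have : 2 * (L * M) = L * ((L + 1) * (L + 2)) := by rw [mul_left_comm, hM2]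
    omega
  · have key : 4 * (L + 1) ^ 3 = ((L + 1) * (L + 2) + 2 * L + 2) + (4 * L ^ 3 + 11 * L ^ 2 + 7 * L) := by
      ring
    omega

/-- **Interpolation at the translates, clean form**: with
`c = 16 · max(1,|η|⁻¹)(1+|ξ|)max(1,|r|⁻¹) · |s| · min(1, |s|−1)⁻²` (a constant `≥ 1` depending only
on `r, s, ξ, η`), every ternary form `Q` of degree `L` satisfies
`‖Q‖₁ ≤ c^{(L+1)³} max_{0 ≤ i < (L+1)(L+2)/2} |Q(1, ξ + ir, η sⁱ)|`.
[cite: NguyenRoy2016, Prop. 8 (with the cruder constant of the remark following it)] -/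
theorem l1Norm_le_pow_mul_of_eval_translates {r s ξ η : ℂ} (hr : r ≠ 0) (hη : η ≠ 0)
    (hs : 1 < ‖s‖) {L : ℕ} {Q : MvPolynomial (Fin 3) ℂ} (hQ : Q.IsHomogeneous L) {B : ℝ}
    (hB : ∀ i : ℕ, i < (L + 1) * (L + 2) / 2 →
      ‖MvPolynomial.eval ![1, ξ + i * r, η * s ^ i] Q‖ ≤ B) :
    Nesterenko.l1Norm Q ≤
      (16 * (max 1 ‖η‖⁻¹ * (1 + ‖ξ‖) * max 1 ‖r‖⁻¹) * ‖s‖ * (min 1 (‖s‖ - 1))⁻¹ ^ 2) ^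
        ((L + 1) ^ 3) * B := by
  have h := l1Norm_le_of_eval_translates hr hη hs hQ hB
  obtain ⟨hM, hLM, hML⟩ := triangular_bounds L
  set M := (L + 1) * (L + 2) / 2 with hMdef
  set E := (L + 1) ^ 3 with hE
  set c₁ : ℝ := max 1 ‖η‖⁻¹ * (1 + ‖ξ‖) * max 1 ‖r‖⁻¹ with hc₁
  set S : ℝ := ‖s‖ with hS
  set θ : ℝ := min 1 (‖s‖ - 1) with hθ
  have hθpos : 0 < θ := lt_min one_pos (by linarith)
  have hθi : 1 ≤ θ⁻¹ := one_le_inv_iff₀.mpr ⟨hθpos, min_le_left _ _⟩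
  have hc₁1 : 1 ≤ c₁ := by
    have h1 : 1 ≤ max 1 ‖η‖⁻¹ := le_max_left _ _
    have h2 : 1 ≤ 1 + ‖ξ‖ := le_add_of_nonneg_right (norm_nonneg _)
    have h3 : 1 ≤ max 1 ‖r‖⁻¹ := le_max_left _ _
    calc (1 : ℝ) = 1 * 1 * 1 := by ring
      _ ≤ _ := mul_le_mul (mul_le_mul h1 h2 zero_le_one (by positivity)) h3 zero_le_one
          (by positivity)
  have hS1 : 1 ≤ S := hs.le
  have hB0 : 0 ≤ B := (norm_nonneg _).trans (hB 0 (Nat.div_pos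
    (by have key : (L + 1) * (L + 2) = 2 + (L ^ 2 + 3 * L) := by ring
        omega) two_pos))
  have hLE : L ≤ E := by
    rw [hE]; calc L ≤ L + 1 := Nat.le_succ L
      _ ≤ (L + 1) ^ 3 := Nat.le_self_pow (by norm_num) _
  -- the individual factors
  have f1 : ((L + 1 : ℝ)) * ((L + 1) ^ 2 * L.factorial) ≤ (2 : ℝ) ^ (2 * E) := by
    have := succ_pow_three_mul_factorial_le L
    calc ((L + 1 : ℝ)) * ((L + 1) ^ 2 * L.factorial) = ((L + 1) ^ 3 * L.factorial : ℕ) := by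
          push_cast; ring
      _ ≤ ((2 ^ (2 * (L + 1) ^ 3) : ℕ) : ℝ) := by exact_mod_cast this
      _ = 2 ^ (2 * E) := by push_cast; rw [hE]
  have f2 : c₁ ^ L ≤ c₁ ^ E := pow_le_pow_right₀ hc₁1 hLE
  have f3 : (4 : ℝ) ^ M ≤ 4 ^ E := pow_le_pow_right₀ (by norm_num) hM
  have f4 : S ^ (L * M) ≤ S ^ E := pow_le_pow_right₀ hS1 hLM
  have f5 : θ⁻¹ ^ (M + L + 1) ≤ θ⁻¹ ^ (2 * E) := pow_le_pow_right₀ hθi hML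
  -- combine
  calc Nesterenko.l1Norm Q
      ≤ (L + 1) * c₁ ^ L * ((L + 1) ^ 2 * L.factorial * ((4 : ℝ) ^ M * S ^ (L * M) *
          θ⁻¹ ^ (M + L + 1)) * B) := h
    _ = (((L + 1 : ℝ)) * ((L + 1) ^ 2 * L.factorial)) * c₁ ^ L * (4 : ℝ) ^ M * S ^ (L * M) *
          θ⁻¹ ^ (M + L + 1) * B := by ring
    _ ≤ (2 : ℝ) ^ (2 * E) * c₁ ^ E * 4 ^ E * S ^ E * θ⁻¹ ^ (2 * E) * B := by
        gcongr
    _ = (16 * c₁ * S * θ⁻¹ ^ 2) ^ E * B := by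
        clear_value c₁ S θ E
        have h16 : (16 : ℝ) ^ E = 2 ^ (2 * E) * 4 ^ E := by
          rw [pow_mul, ← mul_pow]; norm_num
        rw [mul_pow, mul_pow, mul_pow, ← pow_mul, h16]
        ring

end NguyenRoy

end Literature.NumberTheory.Transcendental
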